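import Summits.Ventures.PercRepro.C026PFunStarPos

/-!
# The equality locus of THEOREM S with a bare probe (p6, gen 17; mine-3 §27 (ii), erratum v27)

At the lower corners `K_i = K_min(x_i)` and with a bare probe, `(P_star) = 0` exactly when every
pendant cell lies on the tight curve `x_i ≥ ½` and at most two of them are non-bare
(`x_i < 1`): **`pFun_star_corner_eq_zero_iff`**.

The proof reads the tensor expansion behind THEOREM S (ii): `(P_star) = ∑_T w_T·V(τ_T)` with
weights `w_T = ∏_{i ∈ T} t_i ∏_{i ∉ T} (1 − t_i) ≥ 0` and type values `V ≥ 0`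
(`pFun_star_corner_eq_sum`); the sum vanishes iff every term does.  At the bare probe the type
value vanishes exactly at `m = 0`, `j ≤ 2` (`starTypeValue_bare_eq_zero_iff`: `m = 0` gives
`5^j − 2·4^j + 2·2^j − 1 = (5^j − 4^j) − (2^j − 1)²`, zero for `j ≤ 2` and positive from
`j = 3`; `m ≥ 1` gives `(5/2)^j 3^m + 2 > 2^{j+m+1}`), and a weight is positive iff `t_i > 0` on
`T` and `t_i < 1` off `T`.  A cell `x_i < ½` then sits in a positive-weight term as `E₀`, three
non-bare curve cells sit together as `HALF` — either way the value is positive; conversely, under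
the condition every positive-weight term has `m = 0` and `j ≤ 2`.
-/

namespace PercRepro

/-- `5^j + 2·2^j > 2·4^j + 1` for `j ≥ 3` (strict form of `five_pow_ineq_a`). -/
theorem five_pow_strict (j : ℕ) (hj : 3 ≤ j) :
    2 * ((2 : ℝ) ^ j * 2 ^ j) + 1 < (5 : ℝ) ^ j + 2 * 2 ^ j := by
  induction j, hj using Nat.le_induction with
  | base => norm_num
  | succ j hj ih =>
    have h2 : (8 : ℝ) ≤ 2 ^ j := by
      calc (8 : ℝ) = 2 ^ 3 := by norm_num
        _ ≤ 2 ^ j := pow_le_pow_right₀ (by norm_num) hj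
    simp only [pow_succ]
    nlinarith [mul_le_mul_of_nonneg_left h2 (by positivity : (0 : ℝ) ≤ 2 ^ j)]

/-- `(5/2)^j 3^m + 2 > 2^{j+m+1}` for `m ≥ 1` (strict form of `five_half_three_pow_ineq`). -/
theorem five_half_three_pow_strict (j m : ℕ) (hm : 1 ≤ m) :
    (2 : ℝ) ^ (j + m + 1) < (5 / 2) ^ j * 3 ^ m + 2 := by
  have h2j : (0 : ℝ) < 2 ^ j := by positivity
  have h2m : (0 : ℝ) < 2 ^ m := by positivity
  have hq : (1 : ℝ) ≤ (5 / 4) ^ j := one_le_pow₀ (by norm_num)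
  rw [pow_add, pow_add, pow_one, five_half_pow_eq]
  rcases Nat.lt_or_ge m 2 with hm2 | hm2
  · have hm1 : m = 1 := by omega
    subst hm1
    rcases Nat.lt_or_ge j 2 with hj2 | hj2
    · interval_cases j <;> norm_num
    · have hq' : (25 : ℝ) / 16 ≤ (5 / 4) ^ j := by
        calc (25 : ℝ) / 16 = (5 / 4) ^ 2 := by norm_num
          _ ≤ (5 / 4) ^ j := pow_le_pow_right₀ (by norm_num) hj2
      nlinarith [mul_le_mul_of_nonneg_right hq' h2j.le]
  · have h3 : (9 : ℝ) / 4 * 2 ^ m ≤ 3 ^ m := by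
      have : (3 : ℝ) ^ m = (3 / 2) ^ m * 2 ^ m := by rw [← mul_pow]; norm_num
      rw [this]
      refine mul_le_mul_of_nonneg_right ?_ h2m.le
      calc (9 : ℝ) / 4 = (3 / 2) ^ 2 := by norm_num
        _ ≤ (3 / 2) ^ m := pow_le_pow_right₀ (by norm_num) hm2
    nlinarith [mul_le_mul_of_nonneg_right hq h2j.le, mul_le_mul_of_nonneg_left h3 h2j.le,
      mul_le_mul_of_nonneg_right (mul_le_mul_of_nonneg_right hq h2j.le) h2m.le, mul_pos h2j h2m]

/-- **The zero set of the type value at the bare probe**: `V(n, j, m; 1, 1) = 0 ↔ m = 0 ∧ j ≤ 2`. -/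
theorem starTypeValue_bare_eq_zero_iff (n j m : ℕ) :
    starTypeValue n j m 1 1 = 0 ↔ m = 0 ∧ j ≤ 2 := by
  rw [starTypeValue_eq]
  have h2n : (0 : ℝ) < 2 ^ n := by positivity
  rw [mul_eq_zero, or_iff_right h2n.ne']
  rcases Nat.eq_zero_or_pos m with rfl | hm
  · have hh : (2 : ℝ) ^ j * (1 / 2) ^ j = 1 := by rw [← mul_pow]; norm_num
    have h5 : (2 : ℝ) ^ j * (5 / 2) ^ j = 5 ^ j := by rw [← mul_pow]; norm_num
    constructor
    · intro h
      have key : (5 : ℝ) ^ j + 2 * 2 ^ j - 1 - 2 * (2 ^ j * 2 ^ j) = 0 := by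
        linear_combination (2 : ℝ) ^ j * h - h5 + hh
      refine ⟨rfl, ?_⟩
      by_contra hj
      have hj3 : 3 ≤ j := by omega
      linarith [five_pow_strict j hj3]
    · rintro ⟨-, hj⟩
      interval_cases j <;> norm_num
  · have hm' : m ≠ 0 := by omega
    constructor
    · intro h
      exfalso
      have := five_half_three_pow_strict j m hm
      rw [zero_pow hm'] at h
      nlinarith [h, this]
    · rintro ⟨h, -⟩
      exact absurd h hm'

namespace MultiGraph

open Finset

variable {ι : Type*} [Fintype ι] [DecidableEq ι]

/-- The tensor weight of `T`. -/
noncomputable def starTWeight (x : Option ι → ℝ) (T : Finset ι) : ℝ :=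
  (∏ i ∈ T, pieceT (x (some i))) * ∏ i ∈ Tᶜ, (1 - pieceT (x (some i)))

/-- The type assignment of `T`: upper type on `T`, lower type off `T`. -/
noncomputable def starType (x : Option ι → ℝ) (T : Finset ι) (i : ι) : Fin 3 :=
  if i ∈ T then pieceHi (x (some i)) else pieceLo (x (some i))

/-- The type value of `T` at the probe `(Z, K_A)`. -/
noncomputable def starTValue (x : Option ι → ℝ) (T : Finset ι) (Z KA : ℝ) : ℝ :=
  starTypeValue (univ.filter fun i => starType x T i = 2).card
    (univ.filter fun i => starType x T i = 1).card
    (univ.filter fun i => starType x T i = 0).card Z KA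

/-- **The tensor expansion of the corner star** (the decomposition behind THEOREM S (ii)):
`(P_star)(corner) = ∑_T w_T · V(τ_T)`. -/
theorem pFun_star_corner_eq_sum (x : Option ι → ℝ) (hx : ∀ v, 0 ≤ x v ∧ x v ≤ 1) :
    (star ι).pFun none x (fun v => kMin (x v)) univ =
      ∑ T : Finset ι, starTWeight x T * starTValue x T (x none) (kMin (x none)) := by
  rw [pFun_star_eq]
  set t : ι → ℝ := fun i => pieceT (x (some i)) with ht_def
  set lo : ι → Fin 3 := fun i => pieceLo (x (some i)) with hlo_def
  set hi : ι → Fin 3 := fun i => pieceHi (x (some i)) with hhi_def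
  have hfac := fun i => vertex_factors_eq (hx (some i))
  have ha : ∏ i, (3 - x (some i)) = ∏ i, ((1 - t i) * aT (lo i) + t i * aT (hi i)) :=
    Finset.prod_congr rfl fun i _ => (hfac i).1
  have hb : ∏ i, (1 + (2 - x (some i)) * kMin (x (some i))) =
      ∏ i, ((1 - t i) * bT (lo i) + t i * bT (hi i)) :=
    Finset.prod_congr rfl fun i _ => (hfac i).2.1
  have hc : ∏ i, ((2 - x (some i)) * kMin (x (some i)) + x (some i)) =
      ∏ i, ((1 - t i) * cT (lo i) + t i * cT (hi i)) :=
    Finset.prod_congr rfl fun i _ => (hfac i).2.2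
  rw [ha, hb, hc, prod_affine_eq_sum, prod_affine_eq_sum, prod_affine_eq_sum]
  have hconst : (2 : ℝ) ^ (Fintype.card ι + 1) * x none =
      ∑ T : Finset ι, ((∏ i ∈ T, t i) * ∏ i ∈ Tᶜ, (1 - t i)) * (2 ^ (Fintype.card ι + 1) * x none) := by
    rw [← Finset.sum_mul, sum_weights_eq_one, one_mul]
  rw [hconst, Finset.mul_sum, Finset.mul_sum, ← Finset.sum_sub_distrib, ← Finset.sum_add_distrib,
    ← Finset.sum_sub_distrib]
  refine Finset.sum_congr rfl fun T _ => ?_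
  have hτ := closedForm_type_eq (fun i => if i ∈ T then hi i else lo i) (x none) (kMin (x none))
  have hfun : ∀ (f : Fin 3 → ℝ),
      ∏ i, (if i ∈ T then f (hi i) else f (lo i)) = ∏ i, f (if i ∈ T then hi i else lo i) :=
    fun f => Finset.prod_congr rfl fun i _ => by split_ifs <;> rfl
  rw [hfun aT, hfun bT, hfun cT]
  unfold starTWeight starTValue starType
  rw [← hτ]
  ring

/-- The tensor weights are nonnegative. -/
theorem starWeight_nonneg {x : Option ι → ℝ} (hx : ∀ v, 0 ≤ x v ∧ x v ≤ 1) (T : Finset ι) :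
    0 ≤ starTWeight x T :=
  weight_nonneg (fun i => pieceT_mem (hx (some i))) T

/-- A tensor weight is positive iff `t_i > 0` on `T` and `t_i < 1` off `T`. -/
theorem starWeight_pos_iff {x : Option ι → ℝ} (hx : ∀ v, 0 ≤ x v ∧ x v ≤ 1) (T : Finset ι) :
    0 < starTWeight x T ↔
      (∀ i ∈ T, 0 < pieceT (x (some i))) ∧ ∀ i, i ∉ T → pieceT (x (some i)) < 1 := by
  unfold starTWeight
  constructor
  · intro h
    have h1 : ∏ i ∈ T, pieceT (x (some i)) ≠ 0 := fun h0 => by rw [h0, zero_mul] at h; exact lt_irrefl _ h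
    have h2 : ∏ i ∈ Tᶜ, (1 - pieceT (x (some i))) ≠ 0 := fun h0 => by
      rw [h0, mul_zero] at h; exact lt_irrefl _ h
    rw [Ne, Finset.prod_eq_zero_iff] at h1 h2
    refine ⟨fun i hi => lt_of_le_of_ne (pieceT_mem (hx (some i))).1
      (fun h => h1 ⟨i, hi, h.symm⟩), fun i hi => ?_⟩
    have hle := (pieceT_mem (hx (some i))).2
    exact lt_of_le_of_ne hle fun h => h2 ⟨i, Finset.mem_compl.2 hi, by rw [h]; ring⟩
  · rintro ⟨h1, h2⟩
    refine mul_pos (Finset.prod_pos h1) (Finset.prod_pos fun i hi => ?_)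
    linarith [h2 i (Finset.mem_compl.1 hi)]

/-- The type value of `T` at the bare probe is nonnegative. -/
theorem starTValue_bare_nonneg (x : Option ι → ℝ) (T : Finset ι) : 0 ≤ starTValue x T 1 (kMin 1) :=
  starTypeValue_nonneg _ _ _ (by norm_num)

/-- `K_min(1) = 1`. -/
theorem kMin_one : kMin (1 : ℝ) = 1 := by
  unfold kMin
  norm_num

/-- `starTValue x T 1 1 = 0 ↔` no `E₀` and at most two `HALF` in the type assignment of `T`. -/
theorem starTValue_bare_eq_zero_iff (x : Option ι → ℝ) (T : Finset ι) :
    starTValue x T 1 1 = 0 ↔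
      (univ.filter fun i => starType x T i = 0).card = 0 ∧
        (univ.filter fun i => starType x T i = 1).card ≤ 2 :=
  starTypeValue_bare_eq_zero_iff _ _ _

/-- The equality condition: every pendant cell on the tight curve, at most two non-bare. -/
def StarZeroCond (x : Option ι → ℝ) : Prop :=
  (∀ i, 1 / 2 ≤ x (some i)) ∧ (univ.filter fun i => x (some i) < 1).card ≤ 2

/-- Under the condition, every positive-weight term has no `E₀` and at most two `HALF`. -/
theorem starTValue_eq_zero_of_cond {x : Option ι → ℝ} (hx : ∀ v, 0 ≤ x v ∧ x v ≤ 1)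
    (hc : StarZeroCond x) (T : Finset ι) (hw : 0 < starTWeight x T) : starTValue x T 1 1 = 0 := by
  rw [starTValue_bare_eq_zero_iff]
  obtain ⟨hT, hT'⟩ := (starWeight_pos_iff hx T).1 hw
  constructor
  · rw [Finset.card_eq_zero, Finset.filter_eq_empty_iff]
    intro i _ h0
    unfold starType pieceHi pieceLo at h0
    by_cases hi : i ∈ T
    · rw [if_pos hi] at h0
      split_ifs at h0 <;> simp at h0
    · rw [if_neg hi] at h0
      split_ifs at h0 with hle
      · -- `x_i ≤ ½`, hence `x_i = ½` and `t_i = 1`, contradicting `i ∉ T`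
        have hge := hc.1 i
        have ht := hT' i hi
        unfold pieceT at ht
        rw [if_pos hle] at ht
        linarith
      · simp at h0
  · refine le_trans (Finset.card_le_card ?_) hc.2
    intro i hi
    simp only [Finset.mem_filter, Finset.mem_univ, true_and] at hi ⊢
    unfold starType pieceHi pieceLo at hi
    by_cases hiT : i ∈ T
    · rw [if_pos hiT] at hi
      split_ifs at hi with hle
      · linarith
      · simp at hi
    · rw [if_neg hiT] at hi
      split_ifs at hi with hle
      · simp at hi
      · have ht := hT' i hiT
        unfold pieceT at ht
        rw [if_neg hle] at ht
        linarith

/-- A cell below `½` forces a positive term: the set `T` of the other cells with `t_i > 0`. -/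
theorem exists_pos_term_of_lt_half {x : Option ι → ℝ} (hx : ∀ v, 0 ≤ x v ∧ x v ≤ 1) {i₀ : ι}
    (h₀ : x (some i₀) < 1 / 2) :
    ∃ T : Finset ι, 0 < starTWeight x T ∧ 0 < starTValue x T 1 1 := by
  refine ⟨univ.filter fun i => i ≠ i₀ ∧ 0 < pieceT (x (some i)), ?_, ?_⟩
  · rw [starWeight_pos_iff hx]
    refine ⟨fun i hi => (Finset.mem_filter.1 hi).2.2, fun i hi => ?_⟩
    simp only [Finset.mem_filter, Finset.mem_univ, true_and, not_and, not_lt] at hi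
    by_cases hii : i = i₀
    · subst hii
      unfold pieceT
      rw [if_pos h₀.le]
      linarith
    · linarith [hi hii]
  · refine lt_of_le_of_ne (starTValue_bare_nonneg x _ |>.trans_eq (by rw [kMin_one])) fun h => ?_
    rw [eq_comm, starTValue_bare_eq_zero_iff, Finset.card_eq_zero, Finset.filter_eq_empty_iff] at h
    refine h.1 (Finset.mem_univ i₀) ?_
    unfold starType pieceLo
    rw [if_neg (by simp), if_pos h₀.le]

/-- Three non-bare curve cells force a positive term. -/
theorem exists_pos_term_of_three {x : Option ι → ℝ} (hx : ∀ v, 0 ≤ x v ∧ x v ≤ 1)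
    (hge : ∀ i, 1 / 2 ≤ x (some i)) (h3 : 3 ≤ (univ.filter fun i => x (some i) < 1).card) :
    ∃ T : Finset ι, 0 < starTWeight x T ∧ 0 < starTValue x T 1 1 := by
  -- `T` = the cells with `t_i > 0` that are not non-bare curve cells above `½`
  refine ⟨univ.filter fun i => 0 < pieceT (x (some i)) ∧ ¬ (x (some i) < 1 ∧ 1 / 2 < x (some i)),
    ?_, ?_⟩
  · rw [starWeight_pos_iff hx]
    refine ⟨fun i hi => (Finset.mem_filter.1 hi).2.1, fun i hi => ?_⟩
    simp only [Finset.mem_filter, Finset.mem_univ, true_and] at hi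
    by_cases ht : 0 < pieceT (x (some i))
    · have h12 : x (some i) < 1 ∧ 1 / 2 < x (some i) := by
        by_contra hc
        exact hi ⟨ht, hc⟩
      unfold pieceT
      rw [if_neg (by linarith [h12.2])]
      linarith [h12.1]
    · linarith [(pieceT_mem (hx (some i))).1]
  · refine lt_of_le_of_ne (starTValue_bare_nonneg x _ |>.trans_eq (by rw [kMin_one])) fun h => ?_
    rw [eq_comm, starTValue_bare_eq_zero_iff] at h
    -- every non-bare cell is of type `HALF`
    have hsub : (univ.filter fun i => x (some i) < 1) ⊆
        univ.filter fun i => starType x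
          (univ.filter fun i => 0 < pieceT (x (some i)) ∧ ¬ (x (some i) < 1 ∧ 1 / 2 < x (some i)))
          i = 1 := by
      intro i hi
      simp only [Finset.mem_filter, Finset.mem_univ, true_and] at hi ⊢
      unfold starType pieceHi pieceLo
      rcases lt_or_eq_of_le (hge i) with hlt | heq
      · rw [if_neg, if_neg (by linarith)]
        simp only [Finset.mem_filter, Finset.mem_univ, true_and]
        exact fun hmem => hmem.2 ⟨hi, hlt⟩
      · have hmem : i ∈ univ.filter fun i => 0 < pieceT (x (some i)) ∧
            ¬ (x (some i) < 1 ∧ 1 / 2 < x (some i)) := by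
          simp only [Finset.mem_filter, Finset.mem_univ, true_and, not_and, not_lt]
          refine ⟨?_, fun _ => heq.ge⟩
          unfold pieceT
          rw [if_pos heq.ge]
          linarith
        rw [if_pos hmem, if_pos heq.ge]
    have := Finset.card_le_card hsub
    omega

/-- **The equality locus of THEOREM S (bare probe)** (mine-3 §27 (ii), erratum v27): at the lower
corners `K_i = K_min(x_i)` and with a bare probe, `(P_star) = 0` iff every pendant cell lies on
the tight curve `x_i ≥ ½` and at most two are non-bare (`x_i < 1`). -/
theorem pFun_star_corner_eq_zero_iff {x : Option ι → ℝ} (hx : ∀ v, 0 ≤ x v ∧ x v ≤ 1)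
    (hbare : x none = 1) :
    (star ι).pFun none x (fun v => kMin (x v)) univ = 0 ↔ StarZeroCond x := by
  rw [pFun_star_corner_eq_sum x hx, hbare, kMin_one]
  have hnn : ∀ T ∈ (univ : Finset (Finset ι)), 0 ≤ starTWeight x T * starTValue x T 1 1 :=
    fun T _ => mul_nonneg (starWeight_nonneg hx T)
      ((starTValue_bare_nonneg x T).trans_eq (by rw [kMin_one]))
  constructor
  · intro h
    rw [Finset.sum_eq_zero_iff_of_nonneg hnn] at h
    by_contra hc
    have hpos : ∀ T : Finset ι, 0 < starTWeight x T → 0 < starTValue x T 1 1 → False := by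
      intro T hw hv
      have := h T (Finset.mem_univ T)
      rw [mul_eq_zero] at this
      rcases this with h0 | h0
      · linarith
      · linarith
    by_cases hge : ∀ i, 1 / 2 ≤ x (some i)
    · have hcard : ¬ (univ.filter fun i => x (some i) < 1).card ≤ 2 := fun hle => hc ⟨hge, hle⟩
      obtain ⟨T, hw, hv⟩ := exists_pos_term_of_three hx hge (by omega)
      exact hpos T hw hv
    · obtain ⟨i₀, hi₀⟩ := not_forall.1 hge
      obtain ⟨T, hw, hv⟩ := exists_pos_term_of_lt_half hx (not_le.1 hi₀)
      exact hpos T hw hv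
  · intro hc
    rw [Finset.sum_eq_zero_iff_of_nonneg hnn]
    intro T _
    rcases (starWeight_nonneg hx T).lt_or_eq with hw | hw
    · rw [starTValue_eq_zero_of_cond hx hc T hw, mul_zero]
    · rw [← hw, zero_mul]

end MultiGraph

end PercRepro
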